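import Summits.Ventures.HSemireg.WedgeHankelConfluentRank
import Summits.Ventures.HSemireg.WedgeHankelTwoNodes

/-!
# Venture HSemireg — THE HANKEL RANK OF A TWO-NODE CLASS (nodes `0` and `∞`, orders `P+1`, `P′+1`): `rank H_k(q) = min(k+1, P+P′+2)` for
# `k ≤ n − P − P′ − 1`, read off the two-node kernel law and THEOREM H

HONEST FRAMING. Part of the Lean index of the computation cell `pub-hsemireg` (seat p10 gen 15, Sunday typer «UNIFORM-IN-n»).
Finite-dimensional EXTERIOR ALGEBRA over a field + ranks of Hankel matrices ONLY; no variety, no cohomology theory, no sheaf, no Ext group, no semiregularity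
map; nothing here says that HC / HC_CM / HC_AV holds; no Literature fact is declared or used.  Custodian versions as in `WedgeHankelSiegelIdeal` (1/3),
`WedgeHankelConfluentRank` (E6), `WedgeHankelTwoNodes` (E8); FORMULA-N PART A §2.6 THEOREM H.  The dictionary is QUOTED, never asserted.

THIS FILE (continues namespace `Summit.Ventures.HSemireg.Wedge.HankelSiegelIdeal`; imports E6 and E8):
* §39 `dim (SI_k ⊔ xyRich(k, P, P′)) + min(k+1, P+P′+2)·C(n,k) = C(2n,k)` (`finrank_siegelIdeal_sup_xyRich`; block bookkeeping as in E6 §28).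
* §40 **THE TWO-NODE RANK LAW `rank_hankel1_of_two_orders`: `rank H_k(q) = min(k+1, P+P′+2)`** for `q` supported on `[0,P] ∪ [n−P′,n]` with `q_P ≠ 0 ≠ q_{n−P′}`
  and `k + P + P′ + 1 ≤ n` — «the node at infinity counts like any other, with multiplicity» (gen 14 D4's `rank_hankel1_psecSeq` is `P = P′ = 0` with extra
  simple nodes); `finrank_Kr_w_of_two_orders`.
NOT typed: the same at `(λ, ∞)` / `(λ, μ)` (E5's `rank_hankel1_expMul` transports `(λ, ∞)` at once — stated as `rank_hankel1_expMul_add_top`); three nodes;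
anything Ext-side.  Class side only.
-/

open Module

namespace Summit.Ventures.HSemireg.Wedge.HankelSiegelIdeal

open Summit.Ventures.HSemireg.Wedge Summit.Ventures.HSemireg.Wedge.Kunneth Summit.Ventures.HSemireg.Wedge.Hankel
  Summit.Ventures.HSemireg.Wedge.HankelSiegel Summit.Ventures.HSemireg.Wedge.KunnethKernel Summit.Ventures.HSemireg.Wedge.HankelFrameChange

variable (K : Type*) [Field K] {n : ℕ}

/-! ## §39. The dimension of `SI_k ⊔ xyRich(k, P, P′)` -/

/-- the block family of `SI_k ⊔ xyRich(k, P, P′)`: isotropic parts at the blocks with at most `P` x-letters or at most `P′` y-letters, whole blocks between. -/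
noncomputable def cblock2 (n k P P' a : ℕ) : Submodule K (HT K (In n)) :=
  if a ≤ P ∨ k - a ≤ P' then plane K n a (k - a) ⊓ siegelIdeal K n k else plane K n a (k - a)

/-- each block lies in its plane. -/
lemma cblock2_le_plane (k P P' a : ℕ) : cblock2 K n k P P' a ≤ plane K n a (k - a) := by
  unfold cblock2; split_ifs
  · exact inf_le_left
  · exact le_rfl

/-- **`SI_k ⊔ xyRich(k, P, P′)` block by block.** -/
theorem siegelIdeal_sup_xyRich_eq_sup (k P P' : ℕ) :
    siegelIdeal K n k ⊔ xyRich K n k P P' = (Finset.range (k + 1)).sup (cblock2 K n k P P') := by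
  apply le_antisymm
  · refine sup_le ?_ ?_
    · rw [siegelIdeal_eq_sup_blocks' K (n := n) k]
      refine Finset.sup_le fun a ha => ?_
      refine le_trans ?_ (Finset.le_sup (f := cblock2 K n k P P') ha)
      unfold cblock2; split_ifs
      · exact le_rfl
      · exact inf_le_left
    · refine iSup₂_le fun a ha => ?_
      rw [Finset.mem_filter, Finset.mem_Ioc] at ha
      have hmem : a ∈ Finset.range (k + 1) := Finset.mem_range.mpr (by omega)
      have e : cblock2 K n k P P' a = plane K n a (k - a) := if_neg (by omega)
      exact le_trans e.symm.le (Finset.le_sup (f := cblock2 K n k P P') hmem)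
  · refine Finset.sup_le fun a ha => ?_
    rw [Finset.mem_range] at ha
    unfold cblock2; split_ifs with h
    · exact inf_le_right.trans le_sup_left
    · exact (plane_le_xyRich K (by omega) (by omega) (by omega)).trans le_sup_right

/-- dimensions of the blocks. -/
lemma finrank_cblock2_add {k P P' a : ℕ} (ha : a ≤ k) :
    finrank K (cblock2 K n k P P' a) + (if a ≤ P ∨ k - a ≤ P' then n.choose k else 0) = n.choose a * n.choose (k - a) := by
  by_cases h : a ≤ P ∨ k - a ≤ P'
  · have e : cblock2 K n k P P' a = plane K n a (k - a) ⊓ siegelIdeal K n k := if_pos h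
    have := finrank_plane_inf_siegelIdeal K (n := n) a (k - a)
    rw [show a + (k - a) = k by omega] at this
    rw [e, if_pos h]; exact this
  · have e : cblock2 K n k P P' a = plane K n a (k - a) := if_neg h
    rw [e, if_neg h, add_zero, finrank_plane]

omit [Field K] in
/-- the number of isotropic blocks: `#{a ≤ k : a ≤ P ∨ k − a ≤ P′} = min(k+1, P+P′+2)`. -/
lemma card_filter_two (k P P' : ℕ) :
    ((Finset.range (k + 1)).filter fun a => a ≤ P ∨ k - a ≤ P').card = min (k + 1) (P + P' + 2) := by
  by_cases hk : P + P' + 1 ≤ k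
  · have e : (Finset.range (k + 1)).filter (fun a => a ≤ P ∨ k - a ≤ P') = Finset.range (P + 1) ∪ Finset.Icc (k - P') k := by
      ext a; simp only [Finset.mem_filter, Finset.mem_range, Finset.mem_union, Finset.mem_Icc]; omega
    rw [e, Finset.card_union_of_disjoint, Finset.card_range, Nat.card_Icc]
    · omega
    · rw [Finset.disjoint_left]; intro a h1 h2
      rw [Finset.mem_range] at h1; rw [Finset.mem_Icc] at h2; omega
  · have e : (Finset.range (k + 1)).filter (fun a => a ≤ P ∨ k - a ≤ P') = Finset.range (k + 1) := by
      ext a; simp only [Finset.mem_filter, Finset.mem_range]; omega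
    rw [e, Finset.card_range]; omega

/-- `Σ_{a ≤ k} [a ≤ P ∨ k−a ≤ P′]·C(n,k) = min(k+1, P+P′+2)·C(n,k)`. -/
lemma sum_ite_two_eq (k P P' : ℕ) :
    ∑ a ∈ Finset.range (k + 1), (if a ≤ P ∨ k - a ≤ P' then n.choose k else 0) = min (k + 1) (P + P' + 2) * n.choose k := by
  rw [Finset.sum_ite, Finset.sum_const_zero, add_zero, Finset.sum_const, smul_eq_mul, card_filter_two]

/-- **`dim (SI_k ⊔ xyRich(k, P, P′)) + min(k+1, P+P′+2)·C(n,k) = C(2n,k)`.** -/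
theorem finrank_siegelIdeal_sup_xyRich (k P P' : ℕ) :
    finrank K ↥(siegelIdeal K n k ⊔ xyRich K n k P P') + min (k + 1) (P + P' + 2) * n.choose k = (n + n).choose k := by
  rw [siegelIdeal_sup_xyRich_eq_sup, finrank_sup_eq_sum K _ (fun a => k - a) _ (cblock2_le_plane K k P P'), ← sum_ite_two_eq,
    ← Finset.sum_add_distrib, ← sum_choose_mul_choose (n := n) k]
  exact Finset.sum_congr rfl fun a ha => finrank_cblock2_add K (by rw [Finset.mem_range] at ha; omega)

/-! ## §40. The Hankel rank of a two-node class -/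

/-- **`dim Kr(univ, w_n(q), k) + min(k+1, P+P′+2)·C(n,k) = C(2n,k)`** for the two-node classes of E8. -/
theorem finrank_Kr_w_of_two_orders {k P P' : ℕ} (hkP : k + P + P' + 1 ≤ n) {q : ℕ → K} (hq : ∀ j, P < j → j < n - P' → q j = 0)
    (hqP : q P ≠ 0) (hqP' : q (n - P') ≠ 0) :
    finrank K (Kr K Finset.univ (w K n n q) k) + min (k + 1) (P + P' + 2) * n.choose k = (n + n).choose k := by
  rw [Kr_w_eq_of_two_orders K hkP hq hqP hqP', finrank_siegelIdeal_sup_xyRich]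

/-- **THE TWO-NODE RANK LAW: `rank H_k(q) = min(k+1, P+P′+2)`** for `q` supported on `[0,P] ∪ [n−P′,n]` with `q_P ≠ 0 ≠ q_{n−P′}` and `k + P + P′ + 1 ≤ n`
— an order-`(P+1)` node at `0` and an order-`(P′+1)` node at `∞` contribute `P + 1` and `P′ + 1` to the catalecticant rank (up to the number of rows). -/
theorem rank_hankel1_of_two_orders {k P P' : ℕ} (hkP : k + P + P' + 1 ≤ n) {q : ℕ → K} (hq : ∀ j, P < j → j < n - P' → q j = 0)
    (hqP : q P ≠ 0) (hqP' : q (n - P') ≠ 0) : (hankel1 K n k q).rank = min (k + 1) (P + P' + 2) := by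
  have h1 := finrank_Kr_w_add_rank K (n := n) k q
  have h2 := finrank_Kr_w_of_two_orders K hkP hq hqP hqP'
  have hpos : 0 < n.choose k := Nat.choose_pos (by omega)
  have h3 : n.choose k * (hankel1 K n k q).rank = n.choose k * min (k + 1) (P + P' + 2) := by
    rw [mul_comm (n.choose k) (min (k + 1) (P + P' + 2))]; omega
  exact Nat.eq_of_mul_eq_mul_left hpos h3

/-- **… AT `(λ, ∞)`**: `rank H_k(expMul λ q) = min(k+1, P+P′+2)` for the same `q` (E6's `rank_hankel1_expMul`). -/
theorem rank_hankel1_expMul_of_two_orders (lam : K) {k P P' : ℕ} (hkP : k + P + P' + 1 ≤ n) {q : ℕ → K}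
    (hq : ∀ j, P < j → j < n - P' → q j = 0) (hqP : q P ≠ 0) (hqP' : q (n - P') ≠ 0) :
    (hankel1 K n k (expMul K lam q)).rank = min (k + 1) (P + P' + 2) := by
  rw [rank_hankel1_expMul, rank_hankel1_of_two_orders K hkP hq hqP hqP']

/-- the pure class at `0` plus the point (`P = P′ = 0`): **`rank H_k(A, 0, …, 0, c) = min(k+1, 2)`** for `A, c ≠ 0`, `k + 1 ≤ n` — gen 7's THEOREM T value `2`
for `1 ≤ k ≤ n − 1`. -/
theorem rank_hankel1_pure_add_point {k : ℕ} (hk : k + 1 ≤ n) {A c : K} (hA : A ≠ 0) (hc : c ≠ 0) :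
    (hankel1 K n k (fun j => if j = 0 then A else if j = n then c else 0)).rank = min (k + 1) 2 :=
  rank_hankel1_of_two_orders K (P := 0) (P' := 0) (by omega)
    (fun j hj hj' => by
      show (if j = 0 then A else if j = n then c else 0) = 0
      rw [if_neg (by omega), if_neg (by omega)])
    (by show (if (0 : ℕ) = 0 then A else if (0 : ℕ) = n then c else 0) ≠ 0; rw [if_pos rfl]; exact hA)
    (by
      show (if n - 0 = 0 then A else if n - 0 = n then c else 0) ≠ 0
      rw [Nat.sub_zero, if_neg (by omega), if_pos rfl]; exact hc)

end Summit.Ventures.HSemireg.Wedge.HankelSiegelIdeal
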